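import Summits.Ventures.YMGap.RobustBall.TransferGap
import Summits.Ventures.YMGap.RobustBall.ZdPairwiseSharp
import HarnessLib

/-!
# Robust ball (Y2) — THE INFINITE-VOLUME TRANSFER-MATRIX GAP WITH THE SHARP EXPLICIT RATE
# (`SU(2)`, `d = 4`: gap `≥ log(1/β_W)` on `0 < β_W ≤ 1/6`; `≥ log(49/4) ≈ 2.505` at `β_W = 1/8`)

HONEST FRAMING: venture file of the cell `pub-ymgap` (QuantumFields programme), track ROBUST-BALL, seat rb-p2 (g12); sequel of
`TransferGap` (the spectral gap `HasInfiniteVolumeGap` from clustering of the DLR state).  LATTICE statements at STRONG COUPLING; the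
rates are Dobrushin-comparison floors (the cell's sharp `ℓ∞`-clustering law `ZdAxis.su2_abs_cov_le_linfty_sharp_law_dim4`, sharp to first
order in the one-link coefficient) on the spectral gap of the transfer matrix `T = e^{-H}` of the INFINITE lattice; nothing about
`β → ∞`, a continuum limit, or Clay.  (For orientation only: the strong-coupling glueball mass is `∼ 4 log(1/β_W)`; the floor here is
`log(1/β_W)`.)

WHAT IS NEW.  `TransferGap.exists_hasInfiniteVolumeGap_of_massGapAt` gives the gap with the EXISTENTIAL rate of `MassGapAt` and needs DLR
uniqueness to make the rate uniform over the limit states.  Here the rate is EXPLICIT and no uniqueness is used: an `ℓ∞`-clustering bound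
`|cov_μ(f,g)| ≤ K_c (Σδ_g)(Σδ_f) qⁿ` for bounded local Lipschitz observables at `ℓ∞`-distance `n`, valid for EVERY DLR state with the same
constants, is converted into the Lipschitz-cylinder clause of `MassGapAt` with rate `c`, `q ≤ e^{-c}` (`lipschitzClause_of_linfty`:
`IsLipschitzCylinder.isLipBound/measurable/abs_le`, `⌊d(Λ₁,Λ₂)⌋ ≥ d − 1`), whence — through ds-3's smoothing bridge and `TransferGap` — the
gap `≥ c` for every odd-torus limit state.
RESULTS: `hasInfiniteVolumeGap_of_linfty` (every `SU(N)`, `N ≥ 1`, `β ≥ 0`); ★★ `suN_hasInfiniteVolumeGap_sharp_dim4` (every `N ≥ 2`, hyp-free,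
't Hooft `0 < b ≤ 1/64`: gap `≥ log((1/2 − 6b)/(4b))`, `N`-uniform); ★★★ `su2_hasInfiniteVolumeGap_law_dim4`:
`0 < β_W ≤ 1/6 ⇒ HasInfiniteVolumeGap (fundamentalLatticeRep 2) (β_W/2) (log(1/β_W))` — THE STRONG-COUPLING SPECTRAL-GAP LAW `m(β_W) ≥ log(1/β_W)`;
★★★ `su2_hasInfiniteVolumeGap_oneEighth : HasInfiniteVolumeGap (fundamentalLatticeRep 2) (1/16) (log(49/4))` (`β_W = 1/8`: the lattice
Hamiltonian of infinite-volume 4D `SU(2)` Yang–Mills has spectral gap `≥ 2.505` in lattice units; with the existential-rate theorem's window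
`9/25` for comparison); non-vacuity from `TransferGap.oddTorusLimitPoints_eq_singleton_of_massGapAt`.  0 sorry, 0 definitions.
References: Osterwalder–Seiler 1978 §2; Seiler LNP 159 Ch. 2; Glimm–Jaffe 1987 §6.1.  Everything here is proved. [folklore]
-/

noncomputable section

open scoped BigOperators Topology ENNReal NNReal
open MeasureTheory Filter ProbabilityTheory Finset
open Literature.MathematicalPhysics.QuantumFieldTheory Literature.MathematicalPhysics.QuantumLattice
open Literature.Probability.LatticeModels (IsOSReconstructible Site)
open Literature.Probability.LatticeModels.DobrushinMetric

namespace Summit.Ventures.YMGap.RobustBall.TransferGap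

/-! ### From an `ℓ∞`-clustering bound to the Lipschitz-cylinder clause of `MassGapAt` -/

section Clause

variable {d N : ℕ}

/-- **`ℓ∞`-clustering bound ⇒ Lipschitz-cylinder clause with explicit rate.**  If under `μ` all bounded measurable local Lipschitz
`f, g` (Lipschitz vectors `δ_f, δ_g` for the Frobenius distance) with supports at `ℓ∞`-distance `≥ n` satisfy
`|cov_μ(f,g)| ≤ K_c (Σδ_g)(Σδ_f) qⁿ`, `0 < q ≤ e^{-c}`, `c ≥ 0`, then Lipschitz cylinder functions with supports of size `≤ n₀` satisfy
`|cov_μ(G₁,G₂)| ≤ (K_c n₀² e^{c}) e^{-c d(Λ₁,Λ₂)} (K₁K₂ + ‖G₁‖₂‖G₂‖₂)` (the `μ`-clause of `MassGapAt` / of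
`MassGapMassive.covariance_decay_of_lipschitzClustering`, rate `c`). [folklore] -/
theorem lipschitzClause_of_linfty {μ : Measure (LGConfig d (Matrix.specialUnitaryGroup (Fin N) ℂ))} {Kc q c : ℝ}
    (hKc : 0 ≤ Kc) (hq : 0 < q) (hc : 0 ≤ c) (hqc : q ≤ Real.exp (-c))
    (H : ∀ (f g : LGConfig d (Matrix.specialUnitaryGroup (Fin N) ℂ) → ℝ), Measurable f →
      ∀ (Δf : Finset (Literature.MathematicalPhysics.QuantumLattice.ZdEdge d)), DependsOn f (↑Δf : Set (Literature.MathematicalPhysics.QuantumLattice.ZdEdge d)) → ∀ Mf : ℝ, (∀ σ, |f σ| ≤ Mf) →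
      ∀ (δf : Literature.MathematicalPhysics.QuantumLattice.ZdEdge d → ℝ), IsLipBound suFrobDist f δf → Measurable g →
      ∀ (Δg : Finset (Literature.MathematicalPhysics.QuantumLattice.ZdEdge d)), DependsOn g (↑Δg : Set (Literature.MathematicalPhysics.QuantumLattice.ZdEdge d)) → ∀ Mg : ℝ, (∀ σ, |g σ| ≤ Mg) →
      ∀ (δg : Literature.MathematicalPhysics.QuantumLattice.ZdEdge d → ℝ), IsLipBound suFrobDist g δg → ∀ n : ℕ, (∀ x ∈ Δf, ∀ y ∈ Δg, (n : ℝ) ≤ ‖x.1 - y.1‖) →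
        |cov[f, g; μ]| ≤ Kc * (∑ y ∈ Δg, δg y) * (∑ x ∈ Δf, δf x) * q ^ n) :
    ∀ n : ℕ, ∃ c₁ : ℝ,
      ∀ (G₁ G₂ : LGConfig d (Matrix.specialUnitaryGroup (Fin N) ℂ) → ℝ) (Λ₁ Λ₂ : Finset (Literature.MathematicalPhysics.QuantumLattice.ZdEdge d)) (K₁ K₂ : ℝ≥0),
        Λ₁.card ≤ n → Λ₂.card ≤ n → Disjoint Λ₁ Λ₂ →
        IsLipschitzCylinder (fundamentalRep (Fin N)) G₁ Λ₁ K₁ → IsLipschitzCylinder (fundamentalRep (Fin N)) G₂ Λ₂ K₂ →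
          |cov[G₁, G₂; μ]| ≤ c₁ * Real.exp (-c * setDistEdges Λ₁ Λ₂) *
            ((K₁ : ℝ) * K₂ + Real.sqrt (∫ U, G₁ U ^ 2 ∂μ) * Real.sqrt (∫ U, G₂ U ^ 2 ∂μ)) := by
  classical
  intro n
  refine ⟨Kc * n * n * Real.exp c, fun G₁ G₂ Λ₁ Λ₂ K₁ K₂ h₁ h₂ _ hG₁ hG₂ => ?_⟩
  -- the Dobrushin data of the two Lipschitz cylinder functions
  have hA : ∀ a b : Matrix.specialUnitaryGroup (Fin N) ℂ, dist (suEntries a) (suEntries b) ≤ 1 * suFrobDist a b :=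
    fun a b => by rw [one_mul]; exact dist_suEntries_le_suFrobDist a b
  have hL₁ := hG₁.isLipBound zero_le_one hA
  have hL₂ := hG₂.isLipBound zero_le_one hA
  -- the separation: `⌊d(Λ₁,Λ₂)⌋`
  set s : ℝ := setDistEdges Λ₁ Λ₂ with hs
  have hs0 : 0 ≤ s := setDistEdges_nonneg _ _
  have hdist : ∀ x ∈ Λ₁, ∀ y ∈ Λ₂, ((⌊s⌋₊ : ℕ) : ℝ) ≤ ‖x.1 - y.1‖ :=
    ZdAxis.forall_le_norm_of_le_setDistEdges (Nat.floor_le hs0)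
  set n₀ : ℕ := ⌊s⌋₊ with hn₀
  have key := H G₁ G₂ hG₁.measurable Λ₁ hG₁.dependsOn _ hG₁.abs_le _ hL₁ hG₂.measurable Λ₂ hG₂.dependsOn _
    hG₂.abs_le _ hL₂ n₀ hdist
  -- the sums of the Lipschitz vectors
  have hsum₁ : (∑ x ∈ Λ₁, (if x ∈ Λ₁ then 1 * (K₁ : ℝ) else 0)) ≤ n * K₁ := by
    rw [Finset.sum_ite_of_true (fun x hx => hx), Finset.sum_const, nsmul_eq_mul, one_mul]
    exact mul_le_mul_of_nonneg_right (by exact_mod_cast h₁) K₁.2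
  have hsum₂ : (∑ y ∈ Λ₂, (if y ∈ Λ₂ then 1 * (K₂ : ℝ) else 0)) ≤ n * K₂ := by
    rw [Finset.sum_ite_of_true (fun x hx => hx), Finset.sum_const, nsmul_eq_mul, one_mul]
    exact mul_le_mul_of_nonneg_right (by exact_mod_cast h₂) K₂.2
  have hsum₁0 : 0 ≤ ∑ x ∈ Λ₁, (if x ∈ Λ₁ then 1 * (K₁ : ℝ) else 0) :=
    Finset.sum_nonneg fun x _ => by positivity
  have hsum₂0 : 0 ≤ ∑ y ∈ Λ₂, (if y ∈ Λ₂ then 1 * (K₂ : ℝ) else 0) :=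
    Finset.sum_nonneg fun x _ => by positivity
  -- the rate: `q^{n₀} ≤ e^{-c n₀} ≤ e^{c} e^{-c s}`
  have hpow : q ^ n₀ ≤ Real.exp c * Real.exp (-c * s) := by
    have h1 : q ^ n₀ ≤ Real.exp (-c) ^ n₀ := pow_le_pow_left₀ hq.le hqc n₀
    have h2 : Real.exp (-c) ^ n₀ = Real.exp (-c * n₀) := by rw [← Real.exp_nat_mul]; ring_nf
    have h3 : s < n₀ + 1 := Nat.lt_floor_add_one s
    have h4 : Real.exp (-c * n₀) ≤ Real.exp c * Real.exp (-c * s) := by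
      rw [← Real.exp_add]
      exact Real.exp_le_exp.2 (by nlinarith)
    exact h1.trans (h2 ▸ h4)
  have hK₁ : (0 : ℝ) ≤ K₁ := K₁.2
  have hK₂ : (0 : ℝ) ≤ K₂ := K₂.2
  have hsq : 0 ≤ Real.sqrt (∫ U, G₁ U ^ 2 ∂μ) * Real.sqrt (∫ U, G₂ U ^ 2 ∂μ) := by positivity
  calc |cov[G₁, G₂; μ]|
      ≤ Kc * (∑ y ∈ Λ₂, (if y ∈ Λ₂ then 1 * (K₂ : ℝ) else 0)) * (∑ x ∈ Λ₁, (if x ∈ Λ₁ then 1 * (K₁ : ℝ) else 0)) *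
          q ^ n₀ := key
    _ ≤ Kc * (n * K₂) * (n * K₁) * (Real.exp c * Real.exp (-c * s)) := by
        gcongr
    _ = Kc * n * n * Real.exp c * Real.exp (-c * s) * ((K₁ : ℝ) * K₂) := by ring
    _ ≤ Kc * n * n * Real.exp c * Real.exp (-c * s) *
          ((K₁ : ℝ) * K₂ + Real.sqrt (∫ U, G₁ U ^ 2 ∂μ) * Real.sqrt (∫ U, G₂ U ^ 2 ∂μ)) := by
        gcongr
        · exact le_add_of_nonneg_right hsq

end Clause

/-! ### Every `SU(N)`: the spectral gap at an explicit `ℓ∞`-clustering rate -/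

section SUN

variable {N : ℕ}

/-- ★★ **EVERY `SU(N)`, `N ≥ 1`, 't Hooft `β ≥ 0`: an `ℓ∞`-clustering bound valid for EVERY DLR state at tree coupling `N β` — constants
`K_c`, base `q ≤ e^{-c}`, `c > 0` — gives the infinite-volume transfer gap `HasInfiniteVolumeGap (fundamentalLatticeRep N) (N β) c`**
(no uniqueness needed: every odd-torus limit state is a DLR state). [folklore] -/
theorem hasInfiniteVolumeGap_of_linfty (hN : 1 ≤ N) {β Kc q c : ℝ} (hβ : 0 ≤ β) (hKc : 0 ≤ Kc) (hq : 0 < q) (hc : 0 < c)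
    (hqc : q ≤ Real.exp (-c))
    (H : ∀ μ ∈ ymGibbsMeasures (d := 4) (fundamentalRep (Fin N)) ((N : ℝ) * β),
      ∀ (f g : LGConfig 4 (Matrix.specialUnitaryGroup (Fin N) ℂ) → ℝ), Measurable f →
      ∀ (Δf : Finset (Literature.MathematicalPhysics.QuantumLattice.ZdEdge 4)), DependsOn f (↑Δf : Set (Literature.MathematicalPhysics.QuantumLattice.ZdEdge 4)) → ∀ Mf : ℝ, (∀ σ, |f σ| ≤ Mf) →
      ∀ (δf : Literature.MathematicalPhysics.QuantumLattice.ZdEdge 4 → ℝ), IsLipBound suFrobDist f δf → Measurable g →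
      ∀ (Δg : Finset (Literature.MathematicalPhysics.QuantumLattice.ZdEdge 4)), DependsOn g (↑Δg : Set (Literature.MathematicalPhysics.QuantumLattice.ZdEdge 4)) → ∀ Mg : ℝ, (∀ σ, |g σ| ≤ Mg) →
      ∀ (δg : Literature.MathematicalPhysics.QuantumLattice.ZdEdge 4 → ℝ), IsLipBound suFrobDist g δg → ∀ n : ℕ, (∀ x ∈ Δf, ∀ y ∈ Δg, (n : ℝ) ≤ ‖x.1 - y.1‖) →
        |cov[f, g; μ]| ≤ Kc * (∑ y ∈ Δg, δg y) * (∑ x ∈ Δf, δf x) * q ^ n) :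
    HasInfiniteVolumeGap (fundamentalLatticeRep N) ((N : ℝ) * β) c := by
  haveI : SecondCountableTopology (Matrix (Fin N) (Fin N) ℂ) :=
    inferInstanceAs (SecondCountableTopology (Fin N → Fin N → ℂ))
  haveI : SecondCountableTopology (Matrix.specialUnitaryGroup (Fin N) ℂ) :=
    Topology.IsEmbedding.subtypeVal.secondCountableTopology
  have hρc := continuous_fundamentalRep (Fin N)
  have hNβ : 0 ≤ (N : ℝ) * β := by positivity
  refine hasInfiniteVolumeGap_of_localClustering (fundamentalLatticeRep N) hNβ hc ?_
  intro ν _ hν F₁ F₂ h₁ h₂ h₁m h₂m hb₁ hb₂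
  have hνlim : ν ∈ infiniteVolumeLimitPoints (d := 4) (fundamentalRep (Fin N)) ((N : ℝ) * β) :=
    oddTorusLimitPoints_subset_infiniteVolumeLimitPoints (fundamentalLatticeRep N) ((N : ℝ) * β) hν
  have hνG : ν ∈ ymGibbsMeasures (d := 4) (fundamentalRep (Fin N)) ((N : ℝ) * β) :=
    mem_ymGibbsMeasures_of_mem_infiniteVolumeLimitPoints_holds (fundamentalRep (Fin N)) hρc hνlim
  exact MassGapMassive.covariance_decay_of_lipschitzClustering (d := 4) (by norm_num) hN ((N : ℝ) * β) hνG hc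
    (lipschitzClause_of_linfty hKc hq hc.le hqc (H ν hνG)) F₁ F₂ h₁ h₂ h₁m h₂m hb₁ hb₂

/-! ### `SU(2)`, `d = 4`: the sharp explicit cells -/

/-- ★★★ **THE STRONG-COUPLING SPECTRAL-GAP LAW, `SU(2)`, `d = 4`, HYPOTHESIS-FREE: for every `0 < β_W ≤ 1/6` the transfer matrix of the
infinite-volume theory has gap `≥ log(1/β_W)`** — `HasInfiniteVolumeGap (fundamentalLatticeRep 2) (β_W/2) (log(1/β_W))`: every odd-torus limit
state (= the unique DLR state) is Osterwalder–Schrader reconstructible and `‖T|_{Ω^⊥}‖ ≤ β_W`, i.e. `spec H ∖ {0} ⊆ [log(1/β_W), ∞)`.  Input: the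
cell's sharp `ℓ∞`-clustering law `|cov_μ(f,g)| ≤ (16/√β_W)(Σδ_g)(Σδ_f) β_Wⁿ` (`ZdAxis.su2_abs_cov_le_linfty_sharp_law_dim4`).  A floor (the
strong-coupling glueball mass is `≈ 4 log(1/β_W)`); nothing about larger `β_W`. [folklore] -/
theorem su2_hasInfiniteVolumeGap_law_dim4 {βW : ℝ} (hβ0 : 0 < βW) (hβ : βW ≤ 1 / 6) :
    HasInfiniteVolumeGap (fundamentalLatticeRep 2) (βW / 2) (Real.log (1 / βW)) := by
  have e : (((2 : ℕ) : ℝ)) * (βW / 4) = βW / 2 := by push_cast; ring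
  rw [← e]
  have hc : 0 < Real.log (1 / βW) := Real.log_pos (by rw [lt_div_iff₀ hβ0]; linarith)
  refine hasInfiniteVolumeGap_of_linfty (N := 2) (by norm_num) (by positivity) (Kc := 16 / Real.sqrt βW) (by positivity) hβ0 hc
    (le_of_eq ?_) ?_
  · rw [Real.exp_neg, Real.exp_log (by positivity), one_div, inv_inv]
  · intro μ hμ f g hfm Δf hfdep Mf hMf δf hδf hgm Δg hgdep Mg hMg δg hδg n hdist
    exact ZdAxis.su2_abs_cov_le_linfty_sharp_law_dim4 hβ0 hβ hμ hfm hfdep hMf hδf hgm hgdep hMg hδg n hdist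

/-- `HasInfiniteVolumeGap` is monotone in the rate: a gap `≥ m` is a gap `≥ m'` for every `0 < m' ≤ m`. [folklore] -/
theorem hasInfiniteVolumeGap_mono {G : Type} [Group G] [TopologicalSpace G] [IsTopologicalGroup G] [CompactSpace G] [MeasurableSpace G]
    [BorelSpace G] {r : LatticeRep G} {β m m' : ℝ} (h : HasInfiniteVolumeGap r β m) (hm' : 0 < m') (hle : m' ≤ m) :
    HasInfiniteVolumeGap r β m' := by
  intro μ _ hμ
  obtain ⟨hrec, -, hgap⟩ := h μ hμ
  exact ⟨hrec, hm', hgap.trans (Real.exp_le_exp.2 (by linarith))⟩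

/-- ★★ **UNIFORM ("UpTo") FORM OF THE SPECTRAL-GAP LAW, `SU(2)`, `d = 4`**: for `0 < β_W ≤ β₀ ≤ 1/6`, `HasInfiniteVolumeGap (fundamentalLatticeRep 2) (β_W/2) (log(1/β₀))`
— one rate `log(1/β₀)` for the whole segment `(0, β₀]`. [folklore] -/
theorem su2_hasInfiniteVolumeGap_upTo_dim4 {βW β₀ : ℝ} (hβ0 : 0 < βW) (hββ₀ : βW ≤ β₀) (hβ₀ : β₀ ≤ 1 / 6) :
    HasInfiniteVolumeGap (fundamentalLatticeRep 2) (βW / 2) (Real.log (1 / β₀)) := by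
  have h0 : 0 < β₀ := hβ0.trans_le hββ₀
  refine hasInfiniteVolumeGap_mono (su2_hasInfiniteVolumeGap_law_dim4 hβ0 (hββ₀.trans hβ₀)) (Real.log_pos ?_) ?_
  · rw [lt_div_iff₀ h0]; linarith
  · exact Real.log_le_log (by positivity) (one_div_le_one_div_of_le hβ0 hββ₀)

/-- ★★★ **`SU(2)`, `d = 4`, `β_W = 1/8` (tree coupling `1/16`), HYPOTHESIS-FREE: the infinite-volume transfer matrix has spectral gap
`≥ log(49/4) ≈ 2.505` in lattice units** — `HasInfiniteVolumeGap (fundamentalLatticeRep 2) (1/16) (log(49/4))` (input: the cell's axis-rate cell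
`ZdAxis.su2_abs_cov_le_linfty_sharp_oneEighth`, `|cov| ≤ 40 (Σδ_g)(Σδ_f)(2/7)^{2n}`). [folklore] -/
theorem su2_hasInfiniteVolumeGap_oneEighth :
    HasInfiniteVolumeGap (fundamentalLatticeRep 2) (1 / 16) (Real.log (49 / 4)) := by
  have e : (((2 : ℕ) : ℝ)) * (1 / 32) = 1 / 16 := by push_cast; ring
  rw [← e]
  have hc : 0 < Real.log (49 / 4) := Real.log_pos (by norm_num)
  refine hasInfiniteVolumeGap_of_linfty (N := 2) (by norm_num) (by norm_num) (Kc := 40) (by norm_num) (q := 4 / 49) (by norm_num)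
    hc (le_of_eq ?_) ?_
  · rw [Real.exp_neg, Real.exp_log (by norm_num)]; norm_num
  · intro μ hμ f g hfm Δf hfdep Mf hMf δf hδf hgm Δg hgdep Mg hMg δg hδg n hdist
    have key := ZdAxis.su2_abs_cov_le_linfty_sharp_oneEighth hμ hfm hfdep hMf hδf hgm hgdep hMg hδg n hdist
    have hq : (2 / 7 : ℝ) ^ (2 * n) = (4 / 49 : ℝ) ^ n := by rw [pow_mul]; norm_num
    rw [hq] at key
    exact key

/-- ★★ **EVERY `SU(N)`, `N ≥ 2`, `d = 4`, HYPOTHESIS-FREE (Bakry–Émery modulus), 't Hooft `0 < b ≤ 1/64`: the infinite-volume transfer matrix has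
spectral gap `≥ log((1/2 − 6b)/(4b))`**, `N`-uniform — `HasInfiniteVolumeGap (fundamentalLatticeRep N) (N b) (log((1/2 − 6b)/(4b)))` (input: the cell's
every-`N` sharp `ℓ∞`-clustering `ZdAxis.suN_abs_cov_le_linfty_sharp_dim4`, base `q = 4κ`, `κ = b/(1/2 − 6b)`; at `b = 1/64`: gap `≥ log(13/2) ≈ 1.87`). [folklore] -/
theorem suN_hasInfiniteVolumeGap_sharp_dim4 (hN : 2 ≤ N) {b : ℝ} (hb0 : 0 < b) (hb : b ≤ 1 / 64) :
    HasInfiniteVolumeGap (fundamentalLatticeRep N) ((N : ℝ) * b) (Real.log ((1 / 2 - 6 * b) / (4 * b))) := by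
  have hden : 0 < 1 / 2 - 6 * b := by linarith
  have hκ : 0 < b / (1 / 2 - 6 * b) := div_pos hb0 hden
  have hsq : 0 < Real.sqrt (b / (1 / 2 - 6 * b)) := Real.sqrt_pos.2 hκ
  have hq : (2 * Real.sqrt (b / (1 / 2 - 6 * b))) ^ 2 = 4 * b / (1 / 2 - 6 * b) := by
    rw [mul_pow, Real.sq_sqrt hκ.le]; ring
  have hc : 0 < Real.log ((1 / 2 - 6 * b) / (4 * b)) := by
    refine Real.log_pos ?_
    rw [lt_div_iff₀ (by positivity)]
    linarith
  refine hasInfiniteVolumeGap_of_linfty (N := N) (by omega) hb0.le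
    (Kc := 4 * N / (2 * Real.sqrt (b / (1 / 2 - 6 * b)) * (1 - 1 / 2))) (by positivity) (q := 4 * b / (1 / 2 - 6 * b))
    (by positivity) hc (le_of_eq ?_) ?_
  · rw [Real.exp_neg, Real.exp_log (by positivity), inv_div]
  · intro μ hμ f g hfm Δf hfdep Mf hMf δf hδf hgm Δg hgdep Mg hMg δg hδg n hdist
    have key := ZdAxis.suN_abs_cov_le_linfty_sharp_dim4 hN hb0 hb hμ hfm hfdep hMf hδf hgm hgdep hMg hδg n hdist
    rw [pow_mul, hq] at key
    exact key

/-- **Both cells are non-vacuous**: at `β_W = 1/8` and on `0 < β_W ≤ 1/6` the odd-torus limit states are exactly the unique DLR state, the limit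
of the full torus sequence (`TransferGap.su2_exists_hasInfiniteVolumeGap`). [folklore] -/
theorem su2_oddTorusLimitPoints_eq_singleton {βW : ℝ} (hβ0 : 0 < βW) (hβ : βW ≤ 9 / 25) :
    ∃ μ : Measure (LGConfig 4 (Matrix.specialUnitaryGroup (Fin 2) ℂ)),
      Literature.MathematicalPhysics.QuantumLattice.IsInfiniteVolumeLimit (d := 4) (fundamentalRep (Fin 2)) (βW / 2) μ ∧
        oddTorusLimitPoints (fundamentalLatticeRep 2) (βW / 2) = {μ} := by
  obtain ⟨-, -, -, μ, hlim, -, hodd⟩ := su2_exists_hasInfiniteVolumeGap hβ0 hβ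
  exact ⟨μ, hlim, hodd⟩

end SUN

end Summit.Ventures.YMGap.RobustBall.TransferGap

end
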